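import Literature.MathematicalPhysics.QuantumFieldTheory.Balaban1983to89.B9SupplySockB9P3ZdAtBoundaryMode

/-!
# `Balaban1983to89.B9SupplySockB9P3ZdSocketBoundaryMode` — [Balaban1985RegularSpaces] (1.58)–(1.59) p. 86, p. 77 / [Balaban1985BackgroundPropagators]
# (3.16) p. 393, (3.26)–(3.27) p. 395: THE FOUR-LINE COLLAR SOCKET `SockB9P3D4` (the repaired (1.59) currency R-d of the cube road) IS FALSE AT
# EVERY CUBE MEMBER `{□_j}` OF (1.131) — a kernel certificate by the boundary pure-gauge mode `d(𝟙_{□₀}·c)` and its pure gauge `W = e^{iη d(𝟙·c)}`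

statement-level skeleton of published theorems with citation tags; proofs where landed; nothing here is a claim about the
Yang–Mills mass gap

PDF held: `paper:balaban1985-cmp99-regular-spaces-gauge-fixing` (B8; journal page = PDF page + 74): p. 77 (bond convention, (1.7)–(1.9) `𝔄_k`), p. 82
(1.38), p. 86 (1.55)–(1.59), p. 88 (1.68), p. 99 (1.131); `paper:balaban1985-cmp99-background-propagators` ([4]; journal page = PDF page + 388): p. 393
(3.16) «⟨A, Q*aQA⟩ = Σ_{j=0}^{k} a Σ_{b∈Λ_j} (Lʲη)^{d−2}|(Q_j(U)A)(b)|²», «Λ_j = Ω_j^{(j)} ∖ Ω_{j+1}^{(j)}», p. 395 (3.26)–(3.27) «Δ_a↾Ω₀ = Ω₀Δ_aΩ₀ …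
Dirichlet boundary conditions on Ω₀ᶜ».  Read by this seat on the text layer (2026-08-27).

CITATION HEADER (lean-in-tree rule).  Cell `pub-ymgap` (HUMAN RULING D-0062, Track A), DAG node N06 [B9] → N05 [B8] junction lineage, seat
`pub-ymgap-dag-n06-b` (g10), 2026-08-27; companion of `B9SupplySockB9P3ZdAtBoundaryMode` (p537196 ✓).  A NEW file; nothing landed is modified;
count-neutral; a LOCATED finding about a HYPOTHESIS of landed knits (LOCATED-SELF-3: the socket `B9SupplySockB9P3ZdLettersOmega.SockB9P3D4` is this
lineage's g5 definition of dag-n05-e's repair R-d currency).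

THE MECHANISM (kernel-checked; any C⋆-algebra `𝔸` with `Nontrivial 𝔸`, `d ≥ 2`, `L ≥ 1`).  At a member `i` of the `ℤᵈ` family with a BOUNDARY BOND
`⟨x₀, x₀ + e_μ₀⟩` (`x₀ ∈ Ω₀ ∌ x₀ + e_μ₀`) and the MARGIN «every `x ∈ Ω₀ ∖ Λs m 0` has its ℓ∞-2-neighbourhood in `Ω₀`» (the cube member: `Λs m 0 ⊇ □₀ ∖ □₁`,
`R₁M₁ ≥ 2`), instantiate the socket `SockB9P3D4 L B₀ B_∂ cP η m Ω Λs Λb` at `α₀ = α₂ = cP`, `U₀ = 1`, `A′ = g := d(𝟙_{Ω₀}·c)` with `c = t·1_𝔸`,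
`t = min{cP(Lᵐη)⁻¹, (2η)⁻¹} > 0`, and `W := e^{iηA′}` (`B8Eq184Proof.cfgExp`).  All socket hypotheses hold: `A′` is Hermitian, supported on the
boundary bonds (so `0` off the sides of the plaquettes touching the `Ω_j`), `‖A′‖ ≤ t ≤ cP(Lʲη)⁻¹`; `W` is unitary and EQUALS THE PURE GAUGE
`gaugeAct u 1`, `u = e^{−iη𝟙_{Ω₀}c}` (§2), hence `1, W·1 ∈ 𝔄_m({Ω_j}, cP)` (`B8Ineq132.inAk_gaugeAct_iff`, `B8Prop6OfThm4.one_inAk`); `(iη)⁻¹log W = A′`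
(`ηt ≤ ½ < log 2`) and `A′` is in the Landau gauge of record at truncation `m` (§3, the level-0 multiplier absorbs `Δ(𝟙_{Ω₀}D*A′)` on `Λ₀`).  Line 1 of
the socket then reads `η·t ≤ |A′|₍₋₁₎ ≤ B₀(|J(A′)|₍₋₃₎ + |B₁(A′)|) + B_∂Φ₀(A′) = 0`: `J(A′) = D*_1D_1(dλ) = 0` (flat pure gauge); `|B₁(A′)| = 0` because the
law `ZdIdx.hbox` keeps every constraint bond's box — at level 0 the two end-points — inside `Ω₀`, where `A′ = 0`; `Φ₀(A′) = 0` because the collar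
functional ranges over the sides touching `Ω₀` that are NOT bonds of `Ω₀`, where `A′ = 0` too.  THE BOUNDARY BONDS OF `Ω₀` (one end-point inside)
FALL BETWEEN `|B₁|` (both end-points inside) AND `Φ₀` (no end-point inside).  Print has no such gap: by (3.16) and the p. 77 convention the level-0
constraint bonds are the bonds of `Λ₀ ⊇` boundary layer, INCLUDING the boundary bonds, so print's `|B₁|` sees `A′` there (and print's cube family has
`Ω₀ = T`, (1.131) «Λ′₀ = T ∖ □₁»).

WHAT THIS MODULE PROVES (kernel, 0 sorry, standard axioms).
* §1 the scaled mode: `grad_indicator_eq_zero_of_not_bondTouches`, `grad_indicator_eq_zero_of_inside`, `norm_grad_indicator_le`,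
  `isSelfAdjoint_grad_indicator`, `commute_indicator`, `isSelfAdjoint_real_smul_one`, `norm_real_smul_one`.
* §2 the pure gauge: `cfgExp_mem_unitaryUnits` (`e^{iηA}` unitary for Hermitian `A`), `expUnit_skew_mem_unitaryUnits`, ★ `cfgExp_grad_indicator_eq_gaugeAct`
  (`e^{iη d(𝟙_{Ω₀}c)} = gaugeAct (e^{−iη𝟙_{Ω₀}c}) 1`), ★ `inAk_cfgExp_grad_indicator` (it lies in `𝔄_k({Ω_j}, α)` for every `α > 0`), `logCfg_cfgExp_of_small`
  (`(iη)⁻¹ log e^{iηA} = A` for `η‖A‖ < log 2`).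
* §3 `isLandau138_one_grad_indicator_const` (the mode with a general value `c` is in the Landau gauge of record under the margin).
* §4 `exists_ne_fin`; ★★ `not_sockB9P3D4_of_boundary` (margin + boundary bond + `cP > 0` ⊢ `¬ SockB9P3D4 L B₀ B_∂ cP i.η m i.Ω i.Λs i.Λb`, every `m ≤ k`,
  every `B₀, B_∂`); ★★ `not_sockB9P3D4_cube` (every cube member `Ω = cubeFam false …`, `Λs = cubeLamS …`, `ρ ≥ 2`, every `m ≤ k`); ★★
  `cube_sockD4Family_false` (an all-levels `SockB9P3D4` family over dag-n05-e's cube subtype — the hypothesis of the binder-agnostic consumer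
  `B8Prop6CubeMemberOfThm33.prop6Printed_zdCub_of_sockD4Family` (p537045) VERBATIM — ⊢ `False`, `d, L ≥ 2`, `cP > 0`).

CONSEQUENCES (count-neutral; LOCATED-SELF-3, class MISSTATED-HYPOTHESIS).  Every cube-road knit that takes a `SockB9P3D4` family at the finite cube
members as a hypothesis (`prop6Printed_zdCub_of_sockD4Family`; through the suppliers also `prop6Printed_zdCub_of_thm33[']`, `…_bdry₅_d4` consumers)
is TRUE and VACUOUS as typed; the `Ω₀ = ℤᵈ` road is not hit (`d𝟙_{ℤᵈ} = 0`).  REPAIR (owners' call; the typed departure is ONE set): the level-0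
constraint-bond class must contain the boundary bonds of `Ω₀` as print's `Λ₀`-bonds do — either in the member law (`hbox` at `j = 0` in the p. 77
convention) or in the socket∕binder currency (`|B₁|` over `Λb m j ∪ {level-0 boundary bonds of Ω₀}`), or the collar functional `Φ₀` must range over
all sides touching `Ω₀` that are not INNER bonds; OR the crossing layer is declared DEAD (print's other phrase on p. 395, «Dirichlet boundary
conditions on Ω₀ᶜ», read by the same star rule: fields live on the bonds with both end-points in `Ω₀` — the tree's `intBonds` model reading of
`B9Eq326MultiLevelAssembly`; then `OnDom`, the socket's left-hand norms and `InvAt` shrink by that layer).  Print never adjudicates the layer (void at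
its `Ω₀ = T`) and in either reading has NO live unpinned boundary bond (lit-balaban-r06, B9 owner's first-hand word of record, 2026-08-27).  HONEST SCOPE: refutation of a TYPED hypothesis by an explicit datum; nothing of [B8]∕[B9] is
asserted or denied; N05∕N06 NOT discharged; nothing continuum ∕ ℝ⁴ ∕ OS ∕ mass-gap ∕ Clay.
-/

noncomputable section

open NormedSpace

namespace Literature.MathematicalPhysics.QuantumFieldTheory.Balaban1983to89.B9SupplySockB9P3ZdSocketBoundaryMode

open Complex (I)
open B7Prop1Explicit (e U1 expUnit gaugeAct)
open B7Prop1Local (InBox loK bondHiK)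
open B7Prop2Explicit (unitaryUnits unitaryUnits_le_U1)
open B7Prop4GeneralLevels (linCovIter)
open B7Eq78Linearization (conjR)
open B8Ineq132 (covDerivFwd covDeriv InAk BondTouches PlaqTouches)
open B8Eq140Level (SideTouches)
open B8Eq146AExpansion (iEta plaqCovDeriv)
open B8Eq143PlaqExpansion (pdiv)
open B8Eq155JBound (Jcur wsup)
open B8ScaledSupNorm (bondNorm msup weight Bdd)
open B8Eq138LandauZd (IsLandau138 IsLandau138W QT QprimeT covDivB covLap logCfg)
open B8Eq184Proof (cfgExp)
open B8Lemma1NonAbelian (mulCfg)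
open B8LeafModelZd (ZdIdx)
open B9SupplySockB9P3ZdLettersOmega (SockB9P3D4)
open B9SupplySockB9P3ZdAtBoundaryMode (Jcur_one_grad covDivB_one_grad_eq_zero covLap_eq_zero_of_vanish_near QprimeT_zero_fun
  wsupB1_eq_zero_of_vanish_inside weight_negOne_mono cube_deep cube_corner_boundary_bond)

-- `Site` alone could resolve to the torus sites of `Setup.lean`; re-export the `ℤ^d` sites of `B7Prop1Explicit`.
export B7Prop1Explicit (Site)

variable {d : ℕ} {𝔸 : Type*} [CStarAlgebra 𝔸]

/-! ## §1 The scaled boundary mode `g_c = d(𝟙_{Ω₀}·c)`: values, norms, self-adjointness -/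

/-- The mode `d(𝟙_{Ω₀}·c)` vanishes off the bonds of `Ω₀` (p. 77 convention: no end-point in `Ω₀`). [cite: Balaban1985RegularSpaces, p.77 (convention before (1.5))] -/
theorem grad_indicator_eq_zero_of_not_bondTouches (Ω₀ : Set (Site d)) (c : 𝔸) {y : Site d} {τ : Fin d}
    (h : ¬ BondTouches Ω₀ y τ) : Ω₀.indicator (fun _ => c) (y + e τ) - Ω₀.indicator (fun _ => c) y = 0 := by
  simp only [BondTouches, not_or] at h
  simp [Set.indicator_of_notMem h.1, Set.indicator_of_notMem h.2]

/-- The mode `d(𝟙_{Ω₀}·c)` vanishes on the bonds with both end-points in `Ω₀` (the INNER bonds, where the typed constraint bonds live). [cite: Balaban1985RegularSpaces, p.77 (convention before (1.5)), (1.31) p.82] -/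
theorem grad_indicator_eq_zero_of_inside (Ω₀ : Set (Site d)) (c : 𝔸) {y : Site d} {τ : Fin d}
    (h1 : y ∈ Ω₀) (h2 : y + e τ ∈ Ω₀) : Ω₀.indicator (fun _ => c) (y + e τ) - Ω₀.indicator (fun _ => c) y = 0 := by
  simp [Set.indicator_of_mem h1, Set.indicator_of_mem h2]

/-- `‖d(𝟙_{Ω₀}·c)(b)‖ ≤ ‖c‖` (values `0, ±c`). [cite: Balaban1985RegularSpaces, (1.40) p.83] -/
theorem norm_grad_indicator_le (Ω₀ : Set (Site d)) (c : 𝔸) (y : Site d) (τ : Fin d) :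
    ‖Ω₀.indicator (fun _ => c) (y + e τ) - Ω₀.indicator (fun _ => c) y‖ ≤ ‖c‖ := by
  classical
  by_cases h1 : y + e τ ∈ Ω₀ <;> by_cases h2 : y ∈ Ω₀ <;>
    simp [Set.indicator_of_mem, Set.indicator_of_notMem, h1, h2]

/-- `d(𝟙_{Ω₀}·c)` is Hermitian when `c` is («A′ … with values in 𝔤», p. 82). [cite: Balaban1985RegularSpaces, (1.36) p.82] -/
theorem isSelfAdjoint_grad_indicator (Ω₀ : Set (Site d)) {c : 𝔸} (hc : IsSelfAdjoint c) (y : Site d) (τ : Fin d) :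
    IsSelfAdjoint (Ω₀.indicator (fun _ => c) (y + e τ) - Ω₀.indicator (fun _ => c) y) := by
  classical
  refine IsSelfAdjoint.sub ?_ ?_ <;>
  · simp only [Set.indicator]
    split_ifs
    · exact hc
    · exact IsSelfAdjoint.zero _

/-- The values of `𝟙_{Ω₀}·c` commute with each other (they are `0` or `c`) — what makes `e^{iη dλ}` a pure gauge in a non-abelian `𝔸`. [cite: Balaban1985Averaging, (8) p.18] -/
theorem commute_indicator (Ω₀ : Set (Site d)) (c : 𝔸) (u v : Site d) :
    Commute (Ω₀.indicator (fun _ => c) u) (Ω₀.indicator (fun _ => c) v) := by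
  classical
  by_cases h1 : u ∈ Ω₀ <;> by_cases h2 : v ∈ Ω₀ <;>
    simp [Set.indicator_of_mem, Set.indicator_of_notMem, h1, h2]

/-- `t·1` is Hermitian for real `t`. [cite: Balaban1985RegularSpaces, (1.36) p.82] -/
theorem isSelfAdjoint_real_smul_one (t : ℝ) : IsSelfAdjoint ((t : ℂ) • (1 : 𝔸)) := by
  rw [IsSelfAdjoint, star_smul, star_one, Complex.star_def, Complex.conj_ofReal]

/-- `‖t·1‖ = t` for `t ≥ 0` (C⋆-norm, `‖1‖ = 1`). [cite: Balaban1985RegularSpaces, (1.40) p.83] -/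
theorem norm_real_smul_one [Nontrivial 𝔸] {t : ℝ} (ht : 0 ≤ t) : ‖(t : ℂ) • (1 : 𝔸)‖ = t := by
  rw [norm_smul, Complex.norm_real, Real.norm_of_nonneg ht, norm_one, mul_one]

/-! ## §2 The pure gauge `W = e^{iη g_c}`: unitary, a gauge transform of `1` (so in `𝔄_k`), and `(iη)⁻¹ log W = g_c` -/

/-- **`e^{iηA}` is unitary for a Hermitian bond field `A`** (the configurations `U′ = e^{iηA′}` of (1.36) take values in the group). [cite: Balaban1985RegularSpaces, (1.36) p.82] -/
theorem cfgExp_mem_unitaryUnits (η : ℝ) {A : Site d → Fin d → 𝔸} (hA : ∀ y τ, IsSelfAdjoint (A y τ)) (x : Site d) (κ : Fin d) :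
    cfgExp η A x κ ∈ unitaryUnits 𝔸 := by
  letI : NormedAlgebra ℚ 𝔸 := NormedAlgebra.restrictScalars ℚ ℂ 𝔸
  rw [B7Prop2Explicit.mem_unitaryUnits, cfgExp, B7Prop1Explicit.val_expUnit]
  refine NormedSpace.exp_mem_unitary_of_mem_skewAdjoint ?_
  rw [skewAdjoint.mem_iff, star_smul, star_smul, (hA x κ).star_eq, Complex.star_def, Complex.conj_I, neg_smul]
  simp

/-- `e^{−i a}` is unitary for Hermitian `a` (the gauge transformation `u = e^{iλ}` of [4] p. 393). [cite: Balaban1985BackgroundPropagators, p.393 (before (3.17), «if u = e^{iλ}»)] -/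
theorem expUnit_skew_mem_unitaryUnits {a : 𝔸} (ha : IsSelfAdjoint a) : expUnit (-(I • a)) ∈ unitaryUnits 𝔸 := by
  letI : NormedAlgebra ℚ 𝔸 := NormedAlgebra.restrictScalars ℚ ℂ 𝔸
  rw [B7Prop2Explicit.mem_unitaryUnits, B7Prop1Explicit.val_expUnit]
  refine NormedSpace.exp_mem_unitary_of_mem_skewAdjoint ?_
  rw [skewAdjoint.mem_iff, star_neg, star_smul, ha.star_eq, Complex.star_def, Complex.conj_I, neg_smul, neg_neg]

/-- ★ **THE EXPONENTIATED MODE IS A PURE GAUGE**: `e^{iη d(𝟙_{Ω₀}·c)} = (1)^u` with `u(x) = e^{−iη𝟙_{Ω₀}(x)c}`, i.e. `e^{iη(λ(x+e_μ) − λ(x))} =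
u(x)·1·u(x+e_μ)⁻¹` ((8) of [3]: `V^u(x, x′) = u(x)V(x, x′)u(x′)⁻¹`; the values commute). [cite: Balaban1985Averaging, (8) p.18; Balaban1985BackgroundPropagators, (3.28) p.395] -/
theorem cfgExp_grad_indicator_eq_gaugeAct (η : ℝ) (Ω₀ : Set (Site d)) (c : 𝔸) :
    cfgExp η (fun x μ => Ω₀.indicator (fun _ => c) (x + e μ) - Ω₀.indicator (fun _ => c) x) =
      gaugeAct (fun x => expUnit (-(I • ((η : ℝ) • Ω₀.indicator (fun _ => c) x)))) 1 := by
  letI : NormedAlgebra ℚ 𝔸 := NormedAlgebra.restrictScalars ℚ ℂ 𝔸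
  funext y τ
  apply Units.ext
  simp only [cfgExp, gaugeAct, Pi.one_apply, mul_one, Units.val_mul, B7Prop1Explicit.val_expUnit,
    B7Prop1Explicit.val_inv_expUnit, neg_neg, smul_sub]
  rw [sub_eq_add_neg, add_comm]
  refine exp_add_of_commute ?_
  exact (((commute_indicator Ω₀ c y (y + e τ)).smul_right η).smul_right I |>.smul_left η |>.smul_left I).neg_left

/-- ★ **THE EXPONENTIATED MODE LIES IN `𝔄_k({Ω_j}, α)` FOR EVERY `α > 0`** — «the space 𝔄_k({Ω_j}, α₀) is invariant with respect to gauge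
transformations» (p. 77; `B8Ineq132.inAk_gaugeAct_iff`) and `1 ∈ 𝔄_k` (`B8Prop6OfThm4.one_inAk`). [cite: Balaban1985RegularSpaces, p.77 (last paragraph), (1.7)–(1.9) p.77] -/
theorem inAk_cfgExp_grad_indicator [Nontrivial 𝔸] {L : ℕ} (hL : 1 ≤ L) (k : ℕ) {η α : ℝ} (hη : 0 < η) (hα : 0 < α)
    (Ω : ℕ → Set (Site d)) (Ω₀ : Set (Site d)) {c : 𝔸} (hc : IsSelfAdjoint c) :
    InAk L k η α Ω (cfgExp η (fun x μ => Ω₀.indicator (fun _ => c) (x + e μ) - Ω₀.indicator (fun _ => c) x)) := by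
  rw [cfgExp_grad_indicator_eq_gaugeAct]
  refine (B8Ineq132.inAk_gaugeAct_iff L k η α Ω (fun x => unitaryUnits_le_U1 ?_) 1).2 (B8Prop6OfThm4.one_inAk hL k hη hα Ω)
  have hsa : IsSelfAdjoint ((η : ℝ) • Ω₀.indicator (fun _ => c) x) := by
    classical
    refine IsSelfAdjoint.smul (IsSelfAdjoint.all η) ?_
    simp only [Set.indicator]
    split_ifs
    · exact hc
    · exact IsSelfAdjoint.zero _
  exact expUnit_skew_mem_unitaryUnits hsa

/-- **`(iη)⁻¹ log e^{iηA} = A` when `η‖A‖ < log 2`** (B8 (1.36): `A′ = (iη)⁻¹ log U′` on the small-field side; `B7BlockAvgLog.mlog_exp`). [cite: Balaban1985RegularSpaces, (1.36) p.82] -/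
theorem logCfg_cfgExp_of_small {η : ℝ} (hη : 0 < η) {A : Site d → Fin d → 𝔸} (hA : ∀ y τ, η * ‖A y τ‖ < Real.log 2) :
    logCfg η (cfgExp η A) = A := by
  funext x μ
  have hn : ‖I • ((η : ℝ) • A x μ)‖ < Real.log 2 := by
    rw [norm_smul, Complex.norm_I, one_mul, norm_smul, Real.norm_of_nonneg hη.le]; exact hA x μ
  rw [logCfg, cfgExp, B7Prop1Explicit.val_expUnit, B7BlockAvgLog.mlog_exp hn, smul_smul, inv_mul_cancel₀ Complex.I_ne_zero,
    one_smul, inv_smul_smul₀ hη.ne']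

/-! ## §3 The scaled mode is in the Landau gauge of record (the §4 lemma of the companion file for a general value `c`) -/

/-- **THE MODE `d(𝟙_{Ω₀}·c)` IS IN THE LANDAU GAUGE OF RECORD AT EVERY TRUNCATION LEVEL** under the margin «every site of `Ω₀` outside `Λs 0` has its
ℓ∞-2-neighbourhood in `Ω₀`» — the companion file's `isLandau138_one_grad_indicator` for a general value `c` (same proof: `D^{η*}_1` of the mode lives on
the inner boundary layer, `Δ^η_1` of it within distance one, all inside `Λ₀`, where the level-0 multiplier of (1.42)∕(3.24) is free; higher multipliers zero).
[cite: Balaban1985RegularSpaces, (1.38) p.82, (1.42) p.83, (1.5) p.77; Balaban1985BackgroundPropagators, (3.23)–(3.25) p.394] -/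
theorem isLandau138_one_grad_indicator_const (L m : ℕ) (η : ℝ) {Ω₀ : Set (Site d)} {Λs : ℕ → Set (Site d)} (c : 𝔸)
    (hdeep : ∀ x ∈ Ω₀, x ∉ Λs 0 → ∀ y : Site d, (∀ n, x n - 2 ≤ y n ∧ y n ≤ x n + 2) → y ∈ Ω₀) :
    IsLandau138 L m η Ω₀ Λs (1 : Site d → Fin d → 𝔸ˣ)
      (fun x μ => Ω₀.indicator (fun _ => c) (x + e μ) - Ω₀.indicator (fun _ => c) x) := by
  classical
  set lam : Site d → 𝔸 := Ω₀.indicator (fun _ => c) with hlam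
  set f : Site d → 𝔸 := Ω₀.indicator (covDivB η (1 : Site d → Fin d → 𝔸ˣ) (fun x μ => lam (x + e μ) - lam x)) with hf
  set F : Site d → 𝔸 := fun x => covLap η (1 : Site d → Fin d → 𝔸ˣ) f x with hF
  refine ⟨fun j x => if j = 0 then F x else 0, fun x hx => ?_⟩
  have hRHS : QT L m Λs (1 : Site d → Fin d → 𝔸ˣ) (fun j x => if j = 0 then F x else 0) x = (Λs 0).indicator F x := by
    unfold QT
    rw [Finset.sum_range_succ']
    have hrest : ∑ j ∈ Finset.range m,
        QprimeT L (1 : Site d → Fin d → 𝔸ˣ) (j + 1) ((Λs (j + 1)).indicator ((fun j x => if j = 0 then F x else 0) (j + 1))) x = 0 := by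
      refine Finset.sum_eq_zero (fun j _ => ?_)
      have : (Λs (j + 1)).indicator ((fun (j : ℕ) (x : Site d) => if j = 0 then F x else 0) (j + 1)) = 0 := by
        funext y; simp
      rw [this, QprimeT_zero_fun]; rfl
    rw [hrest, zero_add]
    rfl
  rw [hRHS]
  by_cases hxΛ : x ∈ Λs 0
  · rw [Set.indicator_of_mem hxΛ]
  · rw [Set.indicator_of_notMem hxΛ]
    have hnear : ∀ y : Site d, (∀ n, x n - 1 ≤ y n ∧ y n ≤ x n + 1) → f y = 0 := by
      intro y hy
      have hyΩ : ∀ z : Site d, (∀ n, y n - 1 ≤ z n ∧ z n ≤ y n + 1) → z ∈ Ω₀ := fun z hz =>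
        hdeep x hx hxΛ z (fun n => ⟨by linarith [(hy n).1, (hz n).1], by linarith [(hy n).2, (hz n).2]⟩)
      have hy0 : y ∈ Ω₀ := hyΩ y (fun n => ⟨by linarith, by linarith⟩)
      have hlam1 : ∀ z : Site d, z ∈ Ω₀ → lam z = c := fun z hz => by simp [hlam, Set.indicator_of_mem hz]
      rw [hf, Set.indicator_of_mem hy0]
      refine covDivB_one_grad_eq_zero η lam (fun ν => ?_) (fun ν => ?_)
      · rw [hlam1 y hy0, hlam1 (y + e ν) (hyΩ _ (fun n => ?_))]
        simp only [Pi.add_apply, B7Prop1Explicit.e_apply]; split_ifs <;> omega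
      · rw [hlam1 y hy0, hlam1 (y - e ν) (hyΩ _ (fun n => ?_))]
        simp only [Pi.sub_apply, B7Prop1Explicit.e_apply]; split_ifs <;> omega
    exact covLap_eq_zero_of_vanish_near η 1 (hnear x (fun n => ⟨by linarith, by linarith⟩))
      (fun μ => hnear _ (fun n => by simp only [Pi.add_apply, B7Prop1Explicit.e_apply]; split_ifs <;> omega))
      (fun μ => hnear _ (fun n => by simp only [Pi.sub_apply, B7Prop1Explicit.e_apply]; split_ifs <;> omega))


/-! ## §4 The refutation of the four-line collar socket at every finite-`Ω₀` member with a margin -/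

section Socket

variable [Nontrivial 𝔸]

open B8Eq131CubesAdmissible (cubeFam)
open B8CubeMemberZd (cubeLamS cubeLamB exists_member_cube)

/-- In dimension `d ≥ 2` every direction has another one (a bond is a side of some plaquette). [cite: Balaban1985RegularSpaces, p.77 (convention before (1.5))] -/
theorem exists_ne_fin (hd2 : 2 ≤ d) (μ : Fin d) : ∃ κ : Fin d, κ ≠ μ := by
  by_cases h0 : μ.val = 0
  · exact ⟨⟨1, by omega⟩, fun h => by have := congrArg Fin.val h; simp at this; omega⟩
  · exact ⟨⟨0, by omega⟩, fun h => by have := congrArg Fin.val h; simp at this; omega⟩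

/-- ★★ **THE FOUR-LINE COLLAR SOCKET IS FALSE AT EVERY MEMBER WITH A BOUNDARY BOND AND THE ℓ∞-2 MARGIN**, for every truncation `m ≤ k`, every
`B₀, B_∂` and every `cP > 0`: instantiate `SockB9P3D4` at `α₀ = α₂ = cP`, `U₀ = 1`, `A′ = d(𝟙_{Ω₀}·t1)` (`t = min{cP(Lᵐη)⁻¹, (2η)⁻¹}`), `W = e^{iηA′}`
(unitary, a pure gauge — so `W·1 ∈ 𝔄_m`, Landau of record by §3, `(iη)⁻¹log W = A′`); line 1 gives `η·t ≤ |A′|₍₋₁₎ ≤ B₀(|J(A′)|₍₋₃₎ + |B₁(A′)|) +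
B_∂Φ₀(A′) = B₀(0 + 0) + B_∂·0` — `J = 0` (flat pure gauge), `|B₁| = 0` (`hbox`: constraint bonds are inner), `Φ₀ = 0` (collar = non-bonds of `Ω₀`) —
contradicting `η, t > 0`. [cite: Balaban1985RegularSpaces, (1.58)–(1.59) p.86, p.77 (bond convention), (1.31) p.82, (1.36)–(1.38) p.82; Balaban1985BackgroundPropagators, (3.16) p.393, (3.26)–(3.27) p.395] -/
theorem not_sockB9P3D4_of_boundary (hd2 : 2 ≤ d) {L : ℕ} (hL : 1 ≤ L) (i : ZdIdx d L) {m : ℕ} (hm : m ≤ i.k)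
    (hdeep : ∀ x ∈ i.Ω 0, x ∉ i.Λs m 0 → ∀ y : Site d, (∀ n, x n - 2 ≤ y n ∧ y n ≤ x n + 2) → y ∈ i.Ω 0)
    {x₀ : Site d} {μ₀ : Fin d} (hx₀ : x₀ ∈ i.Ω 0) (hx₁ : x₀ + e μ₀ ∉ i.Ω 0)
    {B₀ Bbd cP : ℝ} (hcP : 0 < cP) :
    ¬ SockB9P3D4 (𝔸 := 𝔸) L B₀ Bbd cP i.η m i.Ω i.Λs i.Λb := by
  classical
  intro H
  have hη : 0 < i.η := i.hη
  have hL1 : (1 : ℝ) ≤ L := by exact_mod_cast hL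
  -- the scale `t` and the value `c = t·1`
  obtain ⟨t, ht_def⟩ : ∃ t : ℝ, t = min (cP * ((L : ℝ) ^ m * i.η)⁻¹) (2 * i.η)⁻¹ := ⟨_, rfl⟩
  have hLm : 0 < (L : ℝ) ^ m * i.η := by positivity
  have ht0 : 0 < t := by rw [ht_def]; exact lt_min (by positivity) (by positivity)
  have ht1 : t ≤ cP * ((L : ℝ) ^ m * i.η)⁻¹ := by rw [ht_def]; exact min_le_left _ _
  have ht2 : t ≤ (2 * i.η)⁻¹ := by rw [ht_def]; exact min_le_right _ _
  set c : 𝔸 := (t : ℂ) • (1 : 𝔸) with hc_def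
  have hc_sa : IsSelfAdjoint c := isSelfAdjoint_real_smul_one t
  have hc_norm : ‖c‖ = t := norm_real_smul_one ht0.le
  -- the mode `g = d(𝟙_{Ω₀}·c)` and the pure gauge `W = e^{iηg}`
  set lam : Site d → 𝔸 := (i.Ω 0).indicator (fun _ => c) with hlam
  set g : Site d → Fin d → 𝔸 := fun x μ => lam (x + e μ) - lam x with hg
  set W : Site d → Fin d → 𝔸ˣ := cfgExp i.η g with hW
  have h1u : ∀ x κ, (1 : Site d → Fin d → 𝔸ˣ) x κ ∈ unitaryUnits 𝔸 := fun _ _ => (unitaryUnits 𝔸).one_mem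
  have hsa : ∀ (y : Site d) (τ : Fin d), IsSelfAdjoint (g y τ) := fun y τ => isSelfAdjoint_grad_indicator (i.Ω 0) hc_sa y τ
  have hWu : ∀ x κ, W x κ ∈ unitaryUnits 𝔸 := fun x κ => cfgExp_mem_unitaryUnits i.η hsa x κ
  have hA1 : InAk L m i.η cP i.Ω (1 : Site d → Fin d → 𝔸ˣ) := B8Prop6OfThm4.one_inAk hL m hη hcP i.Ω
  have hAW : InAk L m i.η cP i.Ω (mulCfg W 1) := by
    rw [B8Thm4Concrete.mulCfg_eq_mul, mul_one, hW, hg, hlam]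
    exact inAk_cfgExp_grad_indicator hL m hη hcP i.Ω (i.Ω 0) hc_sa
  have hgnorm : ∀ (y : Site d) (τ : Fin d), ‖g y τ‖ ≤ t := fun y τ => (norm_grad_indicator_le (i.Ω 0) c y τ).trans hc_norm.le
  have hg_in : ∀ (y : Site d) (τ : Fin d), y ∈ i.Ω 0 → y + e τ ∈ i.Ω 0 → g y τ = 0 := fun y τ h1 h2 =>
    grad_indicator_eq_zero_of_inside (i.Ω 0) c h1 h2
  have hg_off : ∀ (y : Site d) (τ : Fin d), ¬ BondTouches (i.Ω 0) y τ → g y τ = 0 := fun y τ h =>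
    grad_indicator_eq_zero_of_not_bondTouches (i.Ω 0) c h
  have hLan : IsLandau138W L m i.η (i.Ω 0) (i.Λs m) 1 W := by
    unfold IsLandau138W
    have hsmall : ∀ (y : Site d) (τ : Fin d), i.η * ‖g y τ‖ < Real.log 2 := fun y τ =>
      calc i.η * ‖g y τ‖ ≤ i.η * (2 * i.η)⁻¹ := mul_le_mul_of_nonneg_left ((hgnorm y τ).trans ht2) hη.le
        _ = 1 / 2 := by field_simp
        _ < Real.log 2 := by have h := Real.log_two_gt_d9; norm_num at h ⊢; linarith
    rw [hW, logCfg_cfgExp_of_small hη hsmall, hg, hlam]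
    exact isLandau138_one_grad_indicator_const L m i.η c hdeep
  have hsides : ∀ j, j ≤ m → ∀ (y : Site d) (τ : Fin d), SideTouches (i.Ω j) y τ →
      W y τ = cfgExp i.η g y τ ∧ ‖g y τ‖ ≤ cP * ((L : ℝ) ^ j * i.η)⁻¹ := by
    intro j hj y τ _
    refine ⟨rfl, (hgnorm y τ).trans (ht1.trans (mul_le_mul_of_nonneg_left ?_ hcP.le))⟩
    exact inv_anti₀ (by positivity) (mul_le_mul_of_nonneg_right (pow_le_pow_right₀ hL1 hj) hη.le)
  have hoff : ∀ (y : Site d) (τ : Fin d), (∀ j, j ≤ m → ¬ SideTouches (i.Ω j) y τ) → g y τ = 0 := by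
    intro y τ h
    obtain ⟨κ', hκ'⟩ := exists_ne_fin hd2 τ
    exact hg_off y τ (fun hb => h 0 (Nat.zero_le m) (B8Eq140Level.sideTouches_of_bondTouches hκ' hb))
  obtain ⟨h1, -, -, -⟩ := H cP cP hcP le_rfl hcP le_rfl 1 W h1u hWu hA1 hAW hLan g hsa hsides hoff
  -- the right-hand side of line 1 vanishes: `J(g) = 0`, `|B₁(g)| = 0`, `Φ₀(g) = 0`
  have hJ : bondNorm L m i.η (-(3 : ℝ)) i.Ω (fun x μ => Jcur i.η (1 : Site d → Fin d → 𝔸ˣ) g μ x) = 0 := by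
    have : (fun x μ => Jcur i.η (1 : Site d → Fin d → 𝔸ˣ) g μ x) = 0 := by
      funext x μ; rw [hg]; exact Jcur_one_grad i.η lam μ x
    rw [this, B8ScaledSupNorm.bondNorm_zero]
  have hB1 := wsupB1_eq_zero_of_vanish_inside hL i hm (1 : Site d → Fin d → 𝔸ˣ) (B := iEta i.η g)
    (fun z κ h1 h2 => by simp only [iEta]; rw [hg_in z κ h1 h2, smul_zero])
  have hΦ : msup L m i.η (-(1 : ℝ)) (fun j (b : Site d × Fin d) => j = 0 ∧ SideTouches (i.Ω 0) b.1 b.2 ∧ ¬ BondTouches (i.Ω 0) b.1 b.2)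
      (fun b => g b.1 b.2) = 0 := by
    refine le_antisymm (B8ScaledSupNorm.msup_le le_rfl (fun j _ b hb => ?_)) (B8ScaledSupNorm.msup_nonneg L m hη.le _ _ _)
    rw [hg_off b.1 b.2 hb.2.2, norm_zero, mul_zero]
  rw [hJ, hB1, hΦ] at h1
  simp only [add_zero, mul_zero] at h1
  -- the left-hand side of line 1 is at least `η·t > 0`
  have hBdd : Bdd L m i.η (-(1 : ℝ)) (fun j (b : Site d × Fin d) => SideTouches (i.Ω j) b.1 b.2) (fun b => g b.1 b.2) :=
    ⟨weight L i.η (-(1 : ℝ)) m * t, fun j hj b _ =>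
      mul_le_mul (weight_negOne_mono hL hη.le hj) (hgnorm b.1 b.2) (norm_nonneg _) (B8ScaledSupNorm.weight_nonneg L hη.le _ _)⟩
  obtain ⟨κ, hκ⟩ := exists_ne_fin hd2 μ₀
  have hside : SideTouches (i.Ω 0) x₀ μ₀ := B8Eq140Level.sideTouches_of_bondTouches hκ (Or.inl hx₀)
  have hlow := B8ScaledSupNorm.weight_mul_norm_le_msup hBdd (Nat.zero_le m) (i := (x₀, μ₀)) hside
  have hw0 : weight L i.η (-(1 : ℝ)) 0 = i.η := by simp [weight]
  have hgx : ‖g x₀ μ₀‖ = t := by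
    simp only [hg, hlam, Set.indicator_of_mem hx₀, Set.indicator_of_notMem hx₁, zero_sub, norm_neg]; exact hc_norm
  dsimp only at hlow
  rw [hw0, hgx] at hlow
  linarith [mul_pos hη ht0]

/-- ★★ **THE FOUR-LINE COLLAR SOCKET IS FALSE AT EVERY CUBE MEMBER `{□_j}` OF (1.131)** (`Ω = cubeFam false L a M ρ k`, `Λs = cubeLamS …`, `ρ ≥ 2`,
`d ≥ 2`), at every truncation `m ≤ k`, for every `B₀, B_∂` and `cP > 0` (boundary bond at the upper corner of `□₀`; margin from
`B9SupplySockB9P3ZdAtBoundaryMode.cube_deep`). [cite: Balaban1985RegularSpaces, (1.131) p.99, (1.59) p.86, p.98 («R₁M₁Lʲη»); Balaban1985BackgroundPropagators, (3.27) p.395] -/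
theorem not_sockB9P3D4_cube (hd2 : 2 ≤ d) {L : ℕ} (hL : 1 ≤ L) (i : ZdIdx d L) {a : Site d} {M ρ : ℕ} (hρ : 2 ≤ ρ)
    (hΩ : i.Ω = cubeFam false L a M ρ i.k) (hΛs : i.Λs = cubeLamS L a M ρ i.k) {m : ℕ} (hm : m ≤ i.k)
    {B₀ Bbd cP : ℝ} (hcP : 0 < cP) : ¬ SockB9P3D4 (𝔸 := 𝔸) L B₀ Bbd cP i.η m i.Ω i.Λs i.Λb :=
  not_sockB9P3D4_of_boundary hd2 hL i hm (cube_deep hL hρ hΩ hΛs m)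
    (cube_corner_boundary_bond (le_trans one_le_two hρ) hΩ ⟨0, by omega⟩).1
    (cube_corner_boundary_bond (le_trans one_le_two hρ) hΩ ⟨0, by omega⟩).2 hcP

/-- ★★ **AN ALL-LEVELS `SockB9P3D4` FAMILY OVER THE CUBE SUB-FAMILY IS UNSATISFIABLE** — the hypothesis of dag-n05-e's binder-agnostic consumer
`B8Prop6CubeMemberOfThm33.prop6Printed_zdCub_of_sockD4Family` (p537045), VERBATIM over its cube subtype, proves `False` for `d, L ≥ 2` and `cP > 0`
(the subtype is inhabited: `B8CubeMemberZd.exists_member_cube` at `a = 0`, `ρ = L`, `M = 11d + L + 1`, `k = 1`, `η = 1`; then `not_sockB9P3D4_cube` at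
`m = 0`). [cite: Balaban1985RegularSpaces, Prop. 6 p.99, (1.131) p.99, (1.59) p.86; Balaban1985BackgroundPropagators, Thm 3.3 p.399] -/
theorem cube_sockD4Family_false (hd2 : 2 ≤ d) {L : ℕ} (hL : 2 ≤ L) {B₀ Bbd cP : ℝ} (hcP : 0 < cP)
    (hS : ∀ (j : {i : ZdIdx d L // ∃ (a : Site d) (M ρ : ℕ), L ≤ ρ ∧ ρ ≤ M ∧ 11 * d < M ∧ L ≤ d * M ∧
          i.Ω = cubeFam false L a M ρ i.k ∧ i.Λs = cubeLamS L a M ρ i.k ∧ i.Λb = cubeLamB L a M ρ i.k}) (m : ℕ),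
      m ≤ j.1.k → SockB9P3D4 (𝔸 := 𝔸) L B₀ Bbd cP j.1.η m j.1.Ω j.1.Λs j.1.Λb) : False := by
  have hL1 : 1 ≤ L := le_trans one_le_two hL
  have hd : 1 ≤ d := le_trans one_le_two hd2
  obtain ⟨i, hk, -, hΩ, hΛs, hΛb⟩ :=
    exists_member_cube (d := d) hL1 (0 : Site d) (11 * d + L + 1) (le_refl L) (le_refl 1) one_pos
  have hlaw : ∃ (a : Site d) (M ρ : ℕ), L ≤ ρ ∧ ρ ≤ M ∧ 11 * d < M ∧ L ≤ d * M ∧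
      i.Ω = cubeFam false L a M ρ i.k ∧ i.Λs = cubeLamS L a M ρ i.k ∧ i.Λb = cubeLamB L a M ρ i.k := by
    refine ⟨0, 11 * d + L + 1, L, le_rfl, by omega, by omega, ?_, ?_, ?_, ?_⟩
    · calc L ≤ 11 * d + L + 1 := by omega
        _ = 1 * (11 * d + L + 1) := (one_mul _).symm
        _ ≤ d * (11 * d + L + 1) := Nat.mul_le_mul_right _ hd
    · rw [hk]; exact hΩ
    · rw [hk]; exact hΛs
    · rw [hk]; exact hΛb
  exact not_sockB9P3D4_cube hd2 hL1 i hL (by rw [hk]; exact hΩ) (by rw [hk]; exact hΛs) (Nat.zero_le _) hcP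
    (hS ⟨i, hlaw⟩ 0 (Nat.zero_le _))

end Socket

end Literature.MathematicalPhysics.QuantumFieldTheory.Balaban1983to89.B9SupplySockB9P3ZdSocketBoundaryMode

end
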